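import Summits.BirchSwinnertonDyer.BirchSwinnertonDyer.Theorems.ResidualThetaTransportAtTwoThetaTransportResidualSchurAtTwo
import Summits.BirchSwinnertonDyer.BirchSwinnertonDyer.Theorems.ResidualThetaTransportAtTwoThetaTransportResidualKummerAtTwo
import Summits.BirchSwinnertonDyer.BirchSwinnertonDyer.Theorems.ResidualThetaTransportAtTwoResidualEvenSubgroup
import Mathlib.LinearAlgebra.Basis.VectorSpace
import HarnessLib

/-!
# The matrix of `Θ ∘ j` at a place above `2` and its left inverse modulo `2` (crux (R≥)ᵖ, stub `stub_transport` v2, condition at `2`)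

Route `ResidualThetaTransportAtTwo` (RTT), crux (R≥)ᵖ `ResidualThetaCountLowerPureAtTwo` (stmt-BirchSwinnertonDyer-26074),
line «bt26-lambda» v2; seat `prover-bsd-wall-rtt-p2` g12 (`--supports`, closes nothing). HONEST FRAMING: THEOREMS ONLY (no
definition, no named fact, no instance, no `sorry`); CONDITIONAL on the route's print binder `SerreSupersingularDecompositionImageInput`
(Serre 1972 Prop. 12, item stmt-BirchSwinnertonDyer-27793) exactly like `…ResidualSchurAtTwo`; BSD is not proved by any of this.

WHAT. For the θ-datum `Θ_v : A_g ≃ (W[2^∞])ⁿ` (equivariant for the decomposition group at `v ∣ 2`) and the residual isomorphism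
`j : V₂^f ↪ A_g` (`Γ_ℚ`-equivariant, injective; `V₂ = (W[2^∞])[2]`), the composite `Θ_v ∘ j : V₂^f → (W[2^∞])ⁿ` is, entry by
entry, a `D_v`-equivariant additive map `V₂ → V₂`, hence `0` or the identity by the local Schur lemma
(`decomp_equivariant_addMonoidHom_eq_zero_or_eq_id`: `ρ̄_{W,2}(D_v) = GL₂(𝔽₂)` on the habitat). So `Θ_v ∘ j` is an integer matrix
`B ∈ {0,1}^{n×f}` on coordinates (`(Θ_v (j x))_i = ∑_l B_il x_l`), and since `Θ_v ∘ j` is injective and `V₂ ≠ 0`, `B mod 2` has full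
column rank, i.e. admits a left inverse `B'` modulo `2`:
* `schur_torsionBy` — the local Schur lemma transported to the crux carrier `V₂ = (W[2^∞])[2]` (`torsionToPrimary`);
* `exists_matrix_theta_comp` — `∃ B B', (Θ (j x))_i = ∑_l B i l • x_l ∧ (∑_i B' l i * B i l') ≡ δ_{ll'} (mod 2)`.
These are exactly the hypotheses `hB`, `hB'` of `kummer_transport_iff` (file `…ResidualKummerAtTwo`).

References: [SerreInventiones1972] §1.11 Prop. 12, §2.2; [Kobayashi2003] Def. 1.1; [GreenbergVatsal2000] §2 p. 28.
-/

set_option autoImplicit false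
-- the Theorems namespace of this sub repeats the summit name by design (D-0017 nested layout)
set_option linter.dupNamespace false

noncomputable section

open scoped AddSubgroup
open WeierstrassCurve NumberField Field IsDedekindDomain Literature Literature.NumberTheory.EllipticCurves
  Literature.NumberTheory.GaloisRepresentations Literature.NumberTheory.EllipticCurves.Rank1Residual

namespace Summit.BirchSwinnertonDyer.BirchSwinnertonDyer.Theorems.ThetaTransport

variable (W : WeierstrassCurve ℚ) [W.IsElliptic] [W.IsGloballyMinimal]

/-- **Local Schur on the crux carrier `V₂ = (W[2^∞])[2]`** (granted Serre 1972 Prop. 12): an additive endomorphism of `V₂` commuting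
with `resGalOfEmb (closureEmb ℚ_v) δ` for all `δ ∈ Γ_{ℚ_v}`, `v ∣ 2`, is `0` or the identity (transport of
`decomp_equivariant_addMonoidHom_eq_zero_or_eq_id` along `torsionToPrimary : W[2] ≅ V₂`).
[cite: SerreInventiones1972, §1.11 Prop. 12 (c),(d); §2.2] -/
theorem schur_torsionBy (hSe : serre1972_supersingular_decompositionSubgroup_image) (hss : GoodSS W 2)
    (ha2 : W.frobeniusTrace 2 = 0) (v : HeightOneSpectrum (𝓞 ℚ)) (hv : ((2 : ℕ) : 𝓞 ℚ) ∈ v.asIdeal)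
    (w : ↥(AddSubgroup.torsionBy ↥(W.geomPrimaryTorsion 2) (2 : ℤ)) →+ ↥(AddSubgroup.torsionBy ↥(W.geomPrimaryTorsion 2) (2 : ℤ)))
    (hw : ∀ (δ : absoluteGaloisGroup (v.adicCompletion ℚ)) (P : ↥(AddSubgroup.torsionBy ↥(W.geomPrimaryTorsion 2) (2 : ℤ))),
      w (resGalOfEmb (closureEmb (K := ℚ) (v.adicCompletion ℚ)) δ • P) =
        resGalOfEmb (closureEmb (K := ℚ) (v.adicCompletion ℚ)) δ • w P) :
    (∀ P, w P = 0) ∨ (∀ P, w P = P) := by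
  -- the equivariant bijection `t : W[2] ≅ V₂`
  obtain ⟨t, htinj, htsurj, htsmul⟩ : ∃ t : ↥(geomTorsion W 2) →+ ↥(AddSubgroup.torsionBy ↥(W.geomPrimaryTorsion 2) (2 : ℤ)),
      Function.Injective t ∧ Function.Surjective t ∧ ∀ (g : absoluteGaloisGroup ℚ) (P : ↥(geomTorsion W 2)),
        t (g • P) = g • t P :=
    ⟨GreenbergVatsal2000.torsionToPrimary W 2, ResidualLayer.torsionToPrimary_injective W,
      ResidualLayer.torsionToPrimary_surjective W, ResidualLayer.torsionToPrimary_smul W⟩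
  let tE : ↥(geomTorsion W 2) ≃+ ↥(AddSubgroup.torsionBy ↥(W.geomPrimaryTorsion 2) (2 : ℤ)) :=
    AddEquiv.ofBijective t ⟨htinj, htsurj⟩
  have htE : ∀ P, tE P = t P := fun _ ↦ rfl
  have htEsymm : ∀ (g : absoluteGaloisGroup ℚ) (y : ↥(AddSubgroup.torsionBy ↥(W.geomPrimaryTorsion 2) (2 : ℤ))),
      tE.symm (g • y) = g • tE.symm y := fun g y ↦ by
    apply htinj
    rw [htsmul, ← htE, ← htE, tE.apply_symm_apply, tE.apply_symm_apply]
  let u : ↥(geomTorsion W 2) →+ ↥(geomTorsion W 2) :=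
    (tE.symm : _ →+ ↥(geomTorsion W 2)).comp (w.comp (tE : ↥(geomTorsion W 2) →+ _))
  have hu : ∀ P, u P = tE.symm (w (t P)) := fun _ ↦ rfl
  have key := decomp_equivariant_addMonoidHom_eq_zero_or_eq_id W hSe hss ha2 v hv u fun δ P ↦ by
    rw [← resGal_eq_absGaloisRestrict, resGal_eq, hu, hu, htsmul, hw, htEsymm]
  rcases key with h0 | h1
  · refine Or.inl fun P ↦ ?_
    obtain ⟨P, rfl⟩ := htsurj P
    have := h0 P
    rw [hu, tE.symm_apply_eq] at this
    rw [this, map_zero]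
  · refine Or.inr fun P ↦ ?_
    obtain ⟨P, rfl⟩ := htsurj P
    have := h1 P
    rw [hu, tE.symm_apply_eq] at this
    rw [this, htE]

/-- **The matrix of `Θ ∘ j` and its left inverse modulo `2`** (granted Serre 1972 Prop. 12). For `Θ : A ≃ (W[2^∞])ⁿ` equivariant
for `Γ_{ℚ_v}` (`v ∣ 2`) and `j : V₂^f ↪ A` injective and `Γ_ℚ`-equivariant: there are `B ∈ ℕ^{n×f}`, `B' ∈ ℕ^{f×n}` with
`(Θ (j x))_i = ∑_l B i l • x_l` and `∑_i B' l i * B i l' ≡ δ_{ll'} (mod 2)`. Entrywise `V₂ → V₂, P ↦ (Θ (j (δ_l P)))_i` is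
`D_v`-equivariant, so `0` or `id` (`schur_torsionBy`); `B mod 2` has trivial kernel because `Θ ∘ j` is injective and `V₂ ≠ 0`,
whence a left inverse over the field `𝔽₂`. [cite: SerreInventiones1972, §1.11 Prop. 12; §2.2] [cite: Kobayashi2003, Def. 1.1] -/
theorem exists_matrix_theta_comp (hSe : serre1972_supersingular_decompositionSubgroup_image) (hss : GoodSS W 2)
    (ha2 : W.frobeniusTrace 2 = 0) (v : HeightOneSpectrum (𝓞 ℚ)) (hv : ((2 : ℕ) : 𝓞 ℚ) ∈ v.asIdeal)
    {A : Type} [AddCommGroup A] [DistribMulAction (absoluteGaloisGroup ℚ) A] {n f : ℕ}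
    (Θ : A ≃+ (Fin n → ↥(W.geomPrimaryTorsion 2)))
    (hΘ : ∀ (δ : absoluteGaloisGroup (v.adicCompletion ℚ)) (m : A) (i : Fin n),
      Θ (resGalOfEmb (closureEmb (K := ℚ) (v.adicCompletion ℚ)) δ • m) i =
        resGalOfEmb (closureEmb (K := ℚ) (v.adicCompletion ℚ)) δ • Θ m i)
    (j : (Fin f → ↥(AddSubgroup.torsionBy ↥(W.geomPrimaryTorsion 2) (2 : ℤ))) →+ A) (hjinj : Function.Injective j)
    (hjsmul : ∀ (σ : absoluteGaloisGroup ℚ) (x : Fin f → ↥(AddSubgroup.torsionBy ↥(W.geomPrimaryTorsion 2) (2 : ℤ))),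
      j (σ • x) = σ • j x) :
    ∃ (B : Fin n → Fin f → ℕ) (B' : Fin f → Fin n → ℕ),
      (∀ (x : Fin f → ↥(AddSubgroup.torsionBy ↥(W.geomPrimaryTorsion 2) (2 : ℤ))) (i : Fin n),
        Θ (j x) i = ∑ l, B i l • ((x l : ↥(AddSubgroup.torsionBy ↥(W.geomPrimaryTorsion 2) (2 : ℤ))) :
          ↥(W.geomPrimaryTorsion 2))) ∧
      ∀ l l' : Fin f, (∑ i, B' l i * B i l') % 2 = if l = l' then 1 else 0 := by
  classical
  -- `2 x = 0` on `V₂^f`, so the entries of `Θ (j x)` are `2`-torsion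
  have h2V : ∀ P : ↥(AddSubgroup.torsionBy ↥(W.geomPrimaryTorsion 2) (2 : ℤ)), (2 : ℤ) • P = 0 := fun P ↦
    Subtype.ext (by rw [AddSubgroupClass.coe_zsmul, ZeroMemClass.coe_zero]; exact (Submodule.mem_torsionBy_iff (2 : ℤ) _).1 P.2)
  have h2x : ∀ x : Fin f → ↥(AddSubgroup.torsionBy ↥(W.geomPrimaryTorsion 2) (2 : ℤ)), (2 : ℤ) • x = 0 := fun x ↦
    funext fun l ↦ by rw [Pi.smul_apply, h2V, Pi.zero_apply]
  have hmem : ∀ (x : Fin f → ↥(AddSubgroup.torsionBy ↥(W.geomPrimaryTorsion 2) (2 : ℤ))) (i : Fin n),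
      Θ (j x) i ∈ AddSubgroup.torsionBy ↥(W.geomPrimaryTorsion 2) (2 : ℤ) := fun x i ↦ by
    refine (Submodule.mem_torsionBy_iff (2 : ℤ) _).2 ?_
    change (2 : ℤ) • Θ (j x) i = 0
    rw [← Pi.smul_apply, ← map_zsmul, ← map_zsmul, h2x, map_zero, map_zero, Pi.zero_apply]
  -- the entry maps `w i l : V₂ →+ V₂`, `P ↦ (Θ (j (δ_l P)))_i`
  obtain ⟨w, hw⟩ : ∃ w : Fin n → Fin f → (↥(AddSubgroup.torsionBy ↥(W.geomPrimaryTorsion 2) (2 : ℤ)) →+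
      ↥(AddSubgroup.torsionBy ↥(W.geomPrimaryTorsion 2) (2 : ℤ))), ∀ i l P,
      ((w i l P : ↥(AddSubgroup.torsionBy ↥(W.geomPrimaryTorsion 2) (2 : ℤ))) : ↥(W.geomPrimaryTorsion 2)) =
        Θ (j (Pi.single l P)) i :=
    ⟨fun i l ↦
      { toFun := fun P ↦ ⟨Θ (j (Pi.single l P)) i, hmem _ i⟩
        map_zero' := Subtype.ext (by
          change Θ (j (Pi.single l 0)) i = 0
          rw [Pi.single_zero, map_zero, map_zero, Pi.zero_apply])
        map_add' := fun P Q ↦ Subtype.ext (by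
          change Θ (j (Pi.single l (P + Q))) i = Θ (j (Pi.single l P)) i + Θ (j (Pi.single l Q)) i
          rw [Pi.single_add, map_add, map_add, Pi.add_apply]) }, fun _ _ _ ↦ rfl⟩
  -- they commute with the decomposition group, hence are `0` or `id`
  have hwsmul : ∀ i l (δ : absoluteGaloisGroup (v.adicCompletion ℚ)) (P : ↥(AddSubgroup.torsionBy ↥(W.geomPrimaryTorsion 2) (2 : ℤ))),
      w i l (resGalOfEmb (closureEmb (K := ℚ) (v.adicCompletion ℚ)) δ • P) =
        resGalOfEmb (closureEmb (K := ℚ) (v.adicCompletion ℚ)) δ • w i l P := fun i l δ P ↦ by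
    apply Subtype.ext
    rw [hw, Literature.NumberTheory.EllipticCurves.AddSubgroup.torsionBy.coe_smul, hw, Pi.single_smul, hjsmul, hΘ]
  have key : ∀ i l, (∀ P, w i l P = 0) ∨ (∀ P, w i l P = P) := fun i l ↦
    schur_torsionBy W hSe hss ha2 v hv (w i l) (hwsmul i l)
  -- the matrix `B`
  obtain ⟨B, hB1⟩ : ∃ B : Fin n → Fin f → ℕ, ∀ i l (P : ↥(AddSubgroup.torsionBy ↥(W.geomPrimaryTorsion 2) (2 : ℤ))),
      Θ (j (Pi.single l P)) i = B i l • (P : ↥(W.geomPrimaryTorsion 2)) := by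
    refine ⟨fun i l ↦ if (∀ P, w i l P = 0) then 0 else 1, fun i l P ↦ ?_⟩
    beta_reduce
    rcases key i l with h0 | h1
    · rw [if_pos h0, zero_smul, ← hw, h0, ZeroMemClass.coe_zero]
    · by_cases h0 : ∀ P, w i l P = 0
      · rw [if_pos h0, zero_smul, ← hw, h0, ZeroMemClass.coe_zero]
      · rw [if_neg h0, one_smul, ← hw, h1]
  have hB : ∀ (x : Fin f → ↥(AddSubgroup.torsionBy ↥(W.geomPrimaryTorsion 2) (2 : ℤ))) (i : Fin n),
      Θ (j x) i = ∑ l, B i l • ((x l : ↥(AddSubgroup.torsionBy ↥(W.geomPrimaryTorsion 2) (2 : ℤ))) :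
        ↥(W.geomPrimaryTorsion 2)) := fun x i ↦ by
    conv_lhs => rw [← Finset.univ_sum_single x, map_sum, map_sum, Finset.sum_apply]
    exact Finset.sum_congr rfl fun l _ ↦ hB1 i l (x l)
  -- a nonzero point `P₀` of `V₂`, `2`-torsion in `W[2^∞]`
  haveI : Fact (Nat.Prime 2) := ⟨Nat.prime_two⟩
  haveI : NeZero ((2 : ℕ) : ℚ) := ⟨by norm_num⟩
  obtain ⟨P₀, hP₀⟩ : ∃ P₀ : ↥(AddSubgroup.torsionBy ↥(W.geomPrimaryTorsion 2) (2 : ℤ)), P₀ ≠ 0 := by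
    obtain ⟨ρ, e, -⟩ := exists_isTorsionGaloisRep W 2
    obtain ⟨t, htinj⟩ : ∃ t : ↥(geomTorsion W 2) →+ ↥(AddSubgroup.torsionBy ↥(W.geomPrimaryTorsion 2) (2 : ℤ)),
        Function.Injective t := ⟨GreenbergVatsal2000.torsionToPrimary W 2, ResidualLayer.torsionToPrimary_injective W⟩
    refine ⟨t (e.symm fun _ ↦ 1), fun h ↦ ?_⟩
    rw [← map_zero t] at h
    have h' := htinj h
    rw [AddEquiv.symm_apply_eq, map_zero] at h'
    exact one_ne_zero (congr_fun h' 0)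
  have h2P₀ : 2 • ((P₀ : ↥(AddSubgroup.torsionBy ↥(W.geomPrimaryTorsion 2) (2 : ℤ))) : ↥(W.geomPrimaryTorsion 2)) = 0 := by
    have := (Submodule.mem_torsionBy_iff (2 : ℤ) _).1 P₀.2
    rwa [ofNat_zsmul] at this
  -- `B mod 2` has trivial kernel: test against `x = (c_l • P₀)_l`
  let Bbar : Matrix (Fin n) (Fin f) (ZMod 2) := fun i l ↦ (B i l : ZMod 2)
  have hker : ∀ c : Fin f → ZMod 2, Bbar.mulVec c = 0 → c = 0 := by
    intro c hc
    have hx : Θ (j (fun l ↦ (c l).val • P₀)) = 0 := by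
      funext i
      rw [hB, Pi.zero_apply]
      have hsum : ∑ l, B i l • ((((c l).val • P₀ : ↥(AddSubgroup.torsionBy ↥(W.geomPrimaryTorsion 2) (2 : ℤ)))) :
          ↥(W.geomPrimaryTorsion 2)) = (∑ l, B i l * (c l).val) •
            ((P₀ : ↥(AddSubgroup.torsionBy ↥(W.geomPrimaryTorsion 2) (2 : ℤ))) : ↥(W.geomPrimaryTorsion 2)) := by
        rw [Finset.sum_smul]
        refine Finset.sum_congr rfl fun l _ ↦ ?_
        rw [AddSubmonoidClass.coe_nsmul, smul_smul]
      have hpar : (∑ l, B i l * (c l).val) % 2 = 0 % 2 := by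
        refine (ZMod.natCast_eq_natCast_iff' _ _ 2).1 ?_
        have hci : Bbar.mulVec c i = 0 := by rw [hc, Pi.zero_apply]
        rw [Nat.cast_sum, Nat.cast_zero, ← hci]
        change _ = ∑ l, (B i l : ZMod 2) * c l
        refine Finset.sum_congr rfl fun l _ ↦ ?_
        rw [Nat.cast_mul, ZMod.natCast_zmod_val]
      rw [hsum, nsmul_eq_nsmul_of_mod_two_eq h2P₀ hpar, zero_smul]
    have hx0 : (fun l ↦ (c l).val • P₀) = 0 := hjinj (Θ.injective (by rw [hx, map_zero, map_zero]))
    funext l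
    have hl : (c l).val • P₀ = 0 := congr_fun hx0 l
    rw [Pi.zero_apply]
    by_contra hne
    have h1 : (c l).val = 1 := by
      have hlt := ZMod.val_lt (c l)
      have h0 : (c l).val ≠ 0 := fun h ↦ hne ((ZMod.val_eq_zero _).1 h)
      omega
    rw [h1, one_smul] at hl
    exact hP₀ hl
  -- hence a left inverse over `𝔽₂`
  have hkerbot : LinearMap.ker (Matrix.toLin' Bbar) = ⊥ :=
    LinearMap.ker_eq_bot'.2 fun c hc ↦ hker c (by rwa [Matrix.toLin'_apply] at hc)
  obtain ⟨g, hg⟩ := LinearMap.exists_leftInverse_of_injective (Matrix.toLin' Bbar) hkerbot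
  have hmat : LinearMap.toMatrix' g * Bbar = 1 := by
    rw [← LinearMap.toMatrix'_toLin' Bbar, ← LinearMap.toMatrix'_comp, hg, LinearMap.toMatrix'_id]
  refine ⟨B, fun l i ↦ (LinearMap.toMatrix' g l i).val, hB, fun l l' ↦ ?_⟩
  have hcast : ((∑ i, (LinearMap.toMatrix' g l i).val * B i l' : ℕ) : ZMod 2) = (LinearMap.toMatrix' g * Bbar) l l' := by
    rw [Matrix.mul_apply, Nat.cast_sum]
    refine Finset.sum_congr rfl fun i _ ↦ ?_
    rw [Nat.cast_mul, ZMod.natCast_zmod_val]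
  rw [← ZMod.val_natCast, hcast, hmat, Matrix.one_apply]
  split_ifs <;> rfl

end Summit.BirchSwinnertonDyer.BirchSwinnertonDyer.Theorems.ThetaTransport

end
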